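import Literature.NumberTheory.LFunctions.WeilTwoPrimeOddMarginHBase
import Literature.NumberTheory.LFunctions.WeilTwoPrimeOddMarginHDataP22
import Literature.NumberTheory.LFunctions.WeilBlockRowsP
import HarnessLib

/-!
# Two-prime odd-margin certificate H: the materialized block agrees with `P_r`, rows 70–79

`WeilCert.checkPmRow` (row `k` of the claim `Pm_{kl} = P_r(2k+1, 2l+1)`) for certificate H, by `decide +kernel`. Pure proof file; nothing is asserted.
-/

noncomputable section

namespace Literature.NumberTheory.LFunctions

set_option maxHeartbeats 0 in
/-- Row 70 of the materialized block is row 70 of `P_r` (certificate H). [folklore] -/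
theorem checkPmRow1_70_weilCert23H : weilCert23HBase.checkPmRow weilCert23HNu weilCert23HPm 1 70 = true := by
  decide +kernel

set_option maxHeartbeats 0 in
/-- Row 71 of the materialized block is row 71 of `P_r` (certificate H). [folklore] -/
theorem checkPmRow1_71_weilCert23H : weilCert23HBase.checkPmRow weilCert23HNu weilCert23HPm 1 71 = true := by
  decide +kernel

set_option maxHeartbeats 0 in
/-- Row 72 of the materialized block is row 72 of `P_r` (certificate H). [folklore] -/
theorem checkPmRow1_72_weilCert23H : weilCert23HBase.checkPmRow weilCert23HNu weilCert23HPm 1 72 = true := by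
  decide +kernel

set_option maxHeartbeats 0 in
/-- Row 73 of the materialized block is row 73 of `P_r` (certificate H). [folklore] -/
theorem checkPmRow1_73_weilCert23H : weilCert23HBase.checkPmRow weilCert23HNu weilCert23HPm 1 73 = true := by
  decide +kernel

set_option maxHeartbeats 0 in
/-- Row 74 of the materialized block is row 74 of `P_r` (certificate H). [folklore] -/
theorem checkPmRow1_74_weilCert23H : weilCert23HBase.checkPmRow weilCert23HNu weilCert23HPm 1 74 = true := by
  decide +kernel

set_option maxHeartbeats 0 in
/-- Row 75 of the materialized block is row 75 of `P_r` (certificate H). [folklore] -/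
theorem checkPmRow1_75_weilCert23H : weilCert23HBase.checkPmRow weilCert23HNu weilCert23HPm 1 75 = true := by
  decide +kernel

set_option maxHeartbeats 0 in
/-- Row 76 of the materialized block is row 76 of `P_r` (certificate H). [folklore] -/
theorem checkPmRow1_76_weilCert23H : weilCert23HBase.checkPmRow weilCert23HNu weilCert23HPm 1 76 = true := by
  decide +kernel

set_option maxHeartbeats 0 in
/-- Row 77 of the materialized block is row 77 of `P_r` (certificate H). [folklore] -/
theorem checkPmRow1_77_weilCert23H : weilCert23HBase.checkPmRow weilCert23HNu weilCert23HPm 1 77 = true := by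
  decide +kernel

set_option maxHeartbeats 0 in
/-- Row 78 of the materialized block is row 78 of `P_r` (certificate H). [folklore] -/
theorem checkPmRow1_78_weilCert23H : weilCert23HBase.checkPmRow weilCert23HNu weilCert23HPm 1 78 = true := by
  decide +kernel

set_option maxHeartbeats 0 in
/-- Row 79 of the materialized block is row 79 of `P_r` (certificate H). [folklore] -/
theorem checkPmRow1_79_weilCert23H : weilCert23HBase.checkPmRow weilCert23HNu weilCert23HPm 1 79 = true := by
  decide +kernel


end Literature.NumberTheory.LFunctions
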